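import Literature.NumberTheory.GaloisCohomology.FiniteSingularComparison
import Literature.NumberTheory.GaloisRepresentations.LocalGaloisGroupProofs
import Literature.NumberTheory.GaloisRepresentations.LocalFieldCdTwo
import Summits.BirchSwinnertonDyer.Rank1Residual.GaloisImage.InflationRestrictionSakamotoH3
import HarnessLib

/-!
# The canonical finite–singular comparison map, I: Cayley–Hamilton for `Q(φ⁻¹)` and independence
# of the Frobenius on an unramified module
# (cell `b2b-bsdres`, team n1011, seat p04 gen 4, OWNERS row T-HCC; file 1/3)

HONEST FRAMING (cell `b2b-bsdres`, run/shared/lean/b2b/bsd-rank1-residual/, verbatim in every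
file): the goal of the cell is to DELETE the COMBINATION-SHAPED residual classes of the
Birch–Swinnerton-Dyer formula for ALL analytic-rank `≤ 1` elliptic curves over `ℚ` — "full BSD
formula for every rank `≤ 1` curve in class `C`" assembled STRICTLY from published theorems — so
that the rank-`≤ 1` remainder becomes exactly the CONSTRUCTION-SHAPED classes, which are TYPED
(missing-input `Prop`s), NOT attempted. This is not "finishing BSD". Team n1011 (N10 / N11, the
additive block X4 ∧ `p = 3`): research route on the CONSTRUCTION-SHAPED class X4; no claim beyond the
stated classes; nothing is booked. Theorems only (no definition, no named fact, no `sorry`).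

## Why (row T-HCC: the `HasCanonicalComparison` construction)

The tree's `Literature/NumberTheory/GaloisCohomology/FiniteSingularComparison.lean` states, as the
predicate `IsFiniteSingularComparisonWith ρ N fs φ τ` / `KolyvaginDatum.HasCanonicalComparison`,
what it means for the comparison-map slot `fs` of a Kolyvagin datum to be THE canonical
finite–singular comparison map `φ^{fs}` of Rubin (PCMI 18, Def. 1.9.6) = Mazur–Rubin (Def. 1.2.2)
in Kim's generator-fixed form (AJM 148, §2.1.2, §2.2.2):
`H¹_u(K, A) ⥲ A/(ϕ − 1)A →^{Q(ϕ⁻¹)} A^{ϕ=1} ⥲ H¹_t(K, A) ⊗ Gal(L/K)`, `P(x) = det(1 − ϕx | A)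
= (x − 1)Q(x)`.  The N11 instance of Sakamoto 2024 Thm. 4.4 (1) (n1011-p13,
`GaloisImage/SakamotoN11Instance`, p255331; n1011-p18 `…Weil`, p257091) carries a datum `D` with
`D.HasCanonicalComparison (3^(k+1)) η` as a BINDER.  Row T-HCC supplies the construction: the
sequel `GaloisImage/FiniteSingularComparisonLocal` proves the EXISTENCE of `fs` satisfying the
predicate for every arithmetic Frobenius and every inertia element acting by the fixed generator;
this file provides its algebraic half.

## Contents (all for a discrete `Γ_F`-module `ρ` on a free `ℤ/N`-module `M` of finite rank)

* §1 `FSComp.aeval_reflect_mul_pow`, `aeval_reverse_mul_pow`, `aeval_reverse_charpoly_eq_zero`: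
  Mathlib's `eval₂_reverse_mul_pow` (commutative targets only) redone for an inverse pair `g f = 1`
  in a non-commutative algebra; **Cayley–Hamilton at the inverse** `χ_f^{rev}(f⁻¹) = 0`.
* §2 `FSComp.aeval_inv_comparisonP` (**`P(φ⁻¹) = 0`**, Rubin: "By the Cayley-Hamilton theorem,
  `P(ϕ⁻¹)` annihilates `A`"), `comparisonOp_apply_sub` (**`Q(φ⁻¹)(φ m − m) = 0`**: the arrow
  `A/(ϕ−1)A → A^{ϕ=1}` is well defined) and `apply_comparisonOp` (**`φ · Q(φ⁻¹)x = Q(φ⁻¹)x`**: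
  "so `Q(ϕ⁻¹)A ⊂ A^{ϕ=1}`"), both from `P(1) = 0`.
* §3 over a non-archimedean local field `F` with `I_F` acting trivially on `M`: two arithmetic
  Frobenii act identically (`apply_eq_of_isAbsArithFrob`, via `IsFrobPow.mul_inv_mem_absInertia_holds`),
  so `Q(φ⁻¹)` (`comparisonOp_eq_of_isAbsArithFrob`) and the value `z(φ)` of a cocycle vanishing on
  inertia (`cocycle_apply_eq_of_isAbsArithFrob`) do not depend on the Frobenius `φ`; and a
  `φ`-fixed vector of a FINITE unramified module is `Γ_F`-fixed (`forall_apply_eq_of_frob_apply_eq`: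
  Frobenius generates `Γ_F/U` for every open normal `U ⊇ I_F`, tree `exists_pow_eq_mk` from the
  density of the Weil group; `U = ker ρ` is open, `InflRes.isOpen_ker_of_finite`), whence
  `apply_comparisonOp_of_unramified`: **`Q(φ⁻¹)x ∈ M^{Γ_F}`**.

References: K. Rubin, *Euler systems and Kolyvagin systems*, IAS/Park City Math. Ser. 18 (2011),
Def. 1.9.6 (p. 14), Prop. 1.4.13 (1), Prop. 1.9.5; B. Mazur, K. Rubin, *Kolyvagin systems*,
Mem. AMS 799 (2004), Def. 1.2.2; C.-H. Kim, Amer. J. Math. 148 (2026) §2.1.2, §2.2.2; J. Tate,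
*Number theoretic background*, Corvallis (1979) (1.4.1).
-/

noncomputable section

open Field Polynomial
open Literature.NumberTheory.GaloisRepresentations
open Literature.NumberTheory.GaloisRepresentations.DiscreteGaloisModule
open scoped ContRepresentation Polynomial

universe u

namespace Summit.BirchSwinnertonDyer.Rank1Residual.GaloisImage

namespace FSComp

/-! ### §1 Algebra: a reverse polynomial at the inverse; Cayley–Hamilton for `Q(φ⁻¹)` -/

section Reverse

variable {A : Type*} [CommRing A] {E : Type*} [Ring E] [Algebra A E]

/-- `gʲ fʲ = 1` from `g f = 1`. [folklore] -/
theorem pow_mul_pow_eq_one {f g : E} (hgf : g * f = 1) (j : ℕ) : g ^ j * f ^ j = 1 := by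
  induction j with
  | zero => simp
  | succ j ih => rw [pow_succ, pow_succ', mul_assoc, ← mul_assoc g f, hgf, one_mul, ih]

/-- **Reflected polynomial at the inverse**: for `g f = 1` and `deg p ≤ n`,
`p^{refl,n}(g) · fⁿ = p(f)` (Mathlib's `eval₂_reflect_mul_pow`, which assumes a commutative
target, redone for an inverse pair in a possibly non-commutative algebra). [folklore] -/
theorem aeval_reflect_mul_pow {f g : E} (hgf : g * f = 1) (n : ℕ) (p : A[X])
    (hp : p.natDegree ≤ n) : aeval g (reflect n p) * f ^ n = aeval f p := by
  refine induction_with_natDegree_le (fun p => aeval g (reflect n p) * f ^ n = aeval f p) n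
    ?_ ?_ ?_ p hp
  · simp
  · intro k r _ hkn
    rw [reflect_C_mul_X_pow, revAt_le hkn, map_mul, map_mul, aeval_C, aeval_C, aeval_X_pow,
      aeval_X_pow]
    have hn : f ^ n = f ^ (n - k) * f ^ k := by rw [← pow_add, Nat.sub_add_cancel hkn]
    rw [hn, mul_assoc, ← mul_assoc (g ^ (n - k)), pow_mul_pow_eq_one hgf, one_mul]
  · intro p q _ _ hp hq
    rw [reflect_add, map_add, add_mul, hp, hq, map_add]

/-- **Reverse polynomial at the inverse**: `p^{rev}(g) · f^{deg p} = p(f)` for `g f = 1`.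
[folklore] -/
theorem aeval_reverse_mul_pow {f g : E} (hgf : g * f = 1) (p : A[X]) :
    aeval g p.reverse * f ^ p.natDegree = aeval f p :=
  aeval_reflect_mul_pow hgf _ p le_rfl

/-- **Cayley–Hamilton at the inverse**: for an endomorphism `f` of a finite free module with
two-sided inverse `g`, the reverse characteristic polynomial `P(x) = det(1 − f x)` kills `g`:
`P(g) = 0` (`P(g) f^n = χ_f(f) = 0` and `f` is invertible). [folklore] -/
theorem aeval_reverse_charpoly_eq_zero {V : Type*} [AddCommGroup V] [Module A V]
    [Module.Free A V] [Module.Finite A V] {f g : Module.End A V} (hgf : g * f = 1)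
    (hfg : f * g = 1) : aeval g f.charpoly.reverse = 0 := by
  have h := aeval_reverse_mul_pow hgf f.charpoly
  rw [LinearMap.aeval_self_charpoly] at h
  have h2 := congrArg (· * g ^ f.charpoly.natDegree) h
  simp only [zero_mul, mul_assoc, pow_mul_pow_eq_one hfg, mul_one] at h2
  exact h2

end Reverse

/-! ### §2 The operator `Q(φ⁻¹)` on an unramified module: kills `(φ − 1)M`, lands in `M^{φ=1}` -/

section Operator

variable {F : Type u} [Field F] {M : Type u} [AddCommGroup M] [TopologicalSpace M]
  [DiscreteTopology M]
variable (ρ : DiscreteGaloisModule F M) (N : ℕ) [Module (ZMod N) M]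

/-- `zmodEnd` is multiplicative. [folklore] -/
theorem zmodEnd_mul (σ τ : absoluteGaloisGroup F) :
    ρ.zmodEnd N (σ * τ) = ρ.zmodEnd N σ * ρ.zmodEnd N τ := by
  ext m; simp only [zmodEnd_apply, map_mul, Module.End.mul_apply]

/-- `zmodEnd 1 = 1`. [folklore] -/
theorem zmodEnd_one : ρ.zmodEnd N 1 = 1 := by
  ext m; simp only [zmodEnd_apply, map_one, Module.End.one_apply]

/-- `ρ(σ⁻¹) ρ(σ) = 1` on the `ℤ/N`-linear side. [folklore] -/
theorem zmodEnd_inv_mul_self (σ : absoluteGaloisGroup F) :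
    ρ.zmodEnd N σ⁻¹ * ρ.zmodEnd N σ = 1 := by
  rw [← zmodEnd_mul, inv_mul_cancel, zmodEnd_one]

/-- `ρ(σ) ρ(σ⁻¹) = 1` on the `ℤ/N`-linear side. [folklore] -/
theorem zmodEnd_mul_inv_self (σ : absoluteGaloisGroup F) :
    ρ.zmodEnd N σ * ρ.zmodEnd N σ⁻¹ = 1 := by
  rw [← zmodEnd_mul, mul_inv_cancel, zmodEnd_one]

variable [Module.Free (ZMod N) M] [Module.Finite (ZMod N) M]

/-- **`P(φ⁻¹) = 0`** for Rubin's `P(x) = det(1 − φx | M)` (Cayley–Hamilton: `P(φ⁻¹) φⁿ = χ_φ(φ) = 0`).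
Rubin, PCMI 18 (2011), Def. 1.9.6: "By the Cayley-Hamilton theorem, `P(ϕ⁻¹)` annihilates `A`".
[folklore] -/
theorem aeval_inv_comparisonP (φ : absoluteGaloisGroup F) :
    aeval (ρ.zmodEnd N φ⁻¹) (ρ.comparisonP N φ) = 0 := by
  rw [comparisonP_def]
  exact aeval_reverse_charpoly_eq_zero (zmodEnd_inv_mul_self ρ N φ) (zmodEnd_mul_inv_self ρ N φ)

/-- `(φ⁻¹ − 1) · Q(φ⁻¹) = P(φ⁻¹) = 0` as soon as `P(1) = 0` (so that `P = (X − 1)Q`). [folklore] -/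
theorem sub_one_mul_comparisonOp (φ : absoluteGaloisGroup F) (h1 : (ρ.comparisonP N φ).eval 1 = 0) :
    (ρ.zmodEnd N φ⁻¹ - 1) * ρ.comparisonOp N φ = 0 := by
  have h := congrArg (aeval (ρ.zmodEnd N φ⁻¹)) (X_sub_C_mul_comparisonQ ρ N φ h1)
  rw [map_mul, aeval_inv_comparisonP, map_sub, aeval_X, aeval_C, map_one] at h
  rw [comparisonOp_def]; exact h

/-- `Q(φ⁻¹) · (φ⁻¹ − 1) = 0` as soon as `P(1) = 0`. [folklore] -/
theorem comparisonOp_mul_sub_one (φ : absoluteGaloisGroup F) (h1 : (ρ.comparisonP N φ).eval 1 = 0) :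
    ρ.comparisonOp N φ * (ρ.zmodEnd N φ⁻¹ - 1) = 0 := by
  have h := congrArg (aeval (ρ.zmodEnd N φ⁻¹)) (X_sub_C_mul_comparisonQ ρ N φ h1)
  rw [mul_comm, map_mul, aeval_inv_comparisonP, map_sub, aeval_X, aeval_C, map_one] at h
  rw [comparisonOp_def]; exact h

/-- **`Q(φ⁻¹)` kills `(φ − 1)M`**: `Q(φ⁻¹)(φ m − m) = 0` when `P(1) = 0` — the arrow
`A/(ϕ − 1)A →^{Q(ϕ⁻¹)} A^{ϕ=1}` of Rubin Def. 1.9.6 is well defined. [folklore] -/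
theorem comparisonOp_apply_sub (φ : absoluteGaloisGroup F) (h1 : (ρ.comparisonP N φ).eval 1 = 0)
    (m : M) : ρ.comparisonOp N φ (ρ φ m - m) = 0 := by
  have e : ρ.zmodEnd N φ - 1 = (ρ.zmodEnd N φ⁻¹ - 1) * (-ρ.zmodEnd N φ) := by
    rw [sub_mul, one_mul, mul_neg, zmodEnd_inv_mul_self, neg_sub_neg]
  have key : ρ.comparisonOp N φ * (ρ.zmodEnd N φ - 1) = 0 := by
    rw [e, ← mul_assoc, comparisonOp_mul_sub_one ρ N φ h1, zero_mul]
  have h := LinearMap.congr_fun key m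
  simpa only [Module.End.mul_apply, LinearMap.sub_apply, Module.End.one_apply, zmodEnd_apply,
    LinearMap.zero_apply] using h

/-- **`Q(φ⁻¹)` lands in `M^{φ=1}`**: `φ · Q(φ⁻¹) x = Q(φ⁻¹) x` when `P(1) = 0` ("so
`Q(ϕ⁻¹)A ⊂ A^{ϕ=1}`", Rubin Def. 1.9.6). [folklore] -/
theorem apply_comparisonOp (φ : absoluteGaloisGroup F) (h1 : (ρ.comparisonP N φ).eval 1 = 0)
    (x : M) : ρ φ (ρ.comparisonOp N φ x) = ρ.comparisonOp N φ x := by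
  have h := LinearMap.congr_fun (sub_one_mul_comparisonOp ρ N φ h1) x
  simp only [Module.End.mul_apply, LinearMap.sub_apply, Module.End.one_apply, zmodEnd_apply,
    LinearMap.zero_apply, sub_eq_zero] at h
  have h' := congrArg (ρ φ) h
  rw [← Module.End.mul_apply, ← map_mul, mul_inv_cancel, map_one, Module.End.one_apply] at h'
  exact h'.symm

end Operator

/-! ### §3 Unramified modules over a local field: independence of the Frobenius, `Γ_F`-fixed values -/

section Frobenius

variable {F : Type u} [Field F] [ValuativeRel F] [TopologicalSpace F] [IsNonarchimedeanLocalField F]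
variable {M : Type u} [AddCommGroup M] [TopologicalSpace M] [DiscreteTopology M]
variable (ρ : DiscreteGaloisModule F M)

/-- Two arithmetic Frobenii differ by an element of the inertia group, so they act identically on
an UNRAMIFIED module (`IsFrobPow.mul_inv_mem_absInertia_holds`). [folklore] -/
theorem apply_eq_of_isAbsArithFrob (hI : ∀ τ ∈ absInertia F, ρ τ = 1)
    {φ φ' : absoluteGaloisGroup F} (hφ : IsAbsArithFrob φ) (hφ' : IsAbsArithFrob φ') :
    ρ φ = ρ φ' := by
  have hmem : φ * φ'⁻¹ ∈ absInertia F :=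
    IsFrobPow.mul_inv_mem_absInertia_holds (isFrobPow_one_iff_isAbsArithFrob_holds.mpr hφ)
      (isFrobPow_one_iff_isAbsArithFrob_holds.mpr hφ')
  calc ρ φ = ρ (φ * φ'⁻¹ * φ') := by rw [inv_mul_cancel_right]
    _ = ρ φ' := by rw [map_mul, hI _ hmem, one_mul]

omit [ValuativeRel F] [TopologicalSpace F] [IsNonarchimedeanLocalField F] in
/-- If `ρ φ = ρ φ'` then `ρ φ⁻¹ = ρ φ'⁻¹`. [folklore] -/
theorem apply_inv_eq_of_apply_eq {φ φ' : absoluteGaloisGroup F} (h : ρ φ = ρ φ') :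
    ρ φ⁻¹ = ρ φ'⁻¹ := by
  calc ρ φ⁻¹ = ρ (φ⁻¹ * φ' * φ'⁻¹) := by rw [mul_inv_cancel_right]
    _ = ρ φ⁻¹ * ρ φ * ρ φ'⁻¹ := by rw [map_mul, map_mul, h]
    _ = ρ φ'⁻¹ := by rw [← map_mul, inv_mul_cancel, map_one, one_mul]

/-- **`Q(φ⁻¹)` does not depend on the arithmetic Frobenius `φ`** on an unramified module.
[folklore] -/
theorem comparisonOp_eq_of_isAbsArithFrob (N : ℕ) [Module (ZMod N) M] [Module.Free (ZMod N) M]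
    [Module.Finite (ZMod N) M] (hI : ∀ τ ∈ absInertia F, ρ τ = 1)
    {φ φ' : absoluteGaloisGroup F} (hφ : IsAbsArithFrob φ) (hφ' : IsAbsArithFrob φ') :
    ρ.comparisonOp N φ = ρ.comparisonOp N φ' := by
  have h := apply_eq_of_isAbsArithFrob ρ hI hφ hφ'
  have h1 : ρ.zmodEnd N φ = ρ.zmodEnd N φ' := by
    ext m; simp only [zmodEnd_apply, h]
  have h2 : ρ.zmodEnd N φ⁻¹ = ρ.zmodEnd N φ'⁻¹ := by
    ext m; rw [zmodEnd_apply, zmodEnd_apply, apply_inv_eq_of_apply_eq ρ h]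
  simp only [comparisonOp_def, DiscreteGaloisModule.comparisonQ, comparisonP_def, h1, h2]

/-- **The value `z(φ)` of a cocycle vanishing on inertia does not depend on the arithmetic
Frobenius `φ`** (on an unramified module): `z(iφ') = z(i) + i·z(φ') = z(φ')`. [folklore] -/
theorem cocycle_apply_eq_of_isAbsArithFrob (hI : ∀ τ ∈ absInertia F, ρ τ = 1)
    (z : contOneCocycles ρ.toTopRep) (hz : ∀ τ ∈ absInertia F, z.1 τ = 0)
    {φ φ' : absoluteGaloisGroup F} (hφ : IsAbsArithFrob φ) (hφ' : IsAbsArithFrob φ') :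
    z.1 φ = z.1 φ' := by
  have hmem : φ * φ'⁻¹ ∈ absInertia F :=
    IsFrobPow.mul_inv_mem_absInertia_holds (isFrobPow_one_iff_isAbsArithFrob_holds.mpr hφ)
      (isFrobPow_one_iff_isAbsArithFrob_holds.mpr hφ')
  calc z.1 φ = z.1 (φ * φ'⁻¹ * φ') := by rw [inv_mul_cancel_right]
    _ = z.1 (φ * φ'⁻¹) + ρ.toTopRep.ρ (φ * φ'⁻¹) (z.1 φ') := z.2 _ _
    _ = z.1 φ' := by
      rw [hz _ hmem, zero_add]
      change ρ (φ * φ'⁻¹) (z.1 φ') = z.1 φ'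
      rw [hI _ hmem, Module.End.one_apply]

/-- A cocycle vanishing on inertia is unchanged by an inertial perturbation of the argument on
the right: `z(φ i) = z(φ)`. [folklore] -/
theorem cocycle_apply_mul_eq_of_mem_absInertia
    (z : contOneCocycles ρ.toTopRep) (hz : ∀ τ ∈ absInertia F, z.1 τ = 0)
    (φ : absoluteGaloisGroup F) {i : absoluteGaloisGroup F} (hi : i ∈ absInertia F) :
    z.1 (φ * i) = z.1 φ := by
  rw [z.2 φ i, hz i hi, map_zero, add_zero]

/-- **Frobenius and inertia generate: a `φ`-fixed vector of a finite unramified module is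
`Γ_F`-fixed** (every coset of the open kernel is a power of `φ`: tree `exists_pow_eq_mk`, from
the density of the Weil group). Tate, Corvallis (1.4.1). [folklore] -/
theorem forall_apply_eq_of_frob_apply_eq [Finite M] (hI : ∀ τ ∈ absInertia F, ρ τ = 1)
    {φ : absoluteGaloisGroup F} (hφ : IsAbsArithFrob φ) {a : M} (ha : ρ φ a = a)
    (g : absoluteGaloisGroup F) : ρ g a = a := by
  haveI := InflRes.normal_ker ρ
  have hIU : absInertia F ≤ ρ.ker := fun τ hτ => (ρ.mem_ker τ).mpr (hI τ hτ)
  obtain ⟨i, hi⟩ := exists_pow_eq_mk F (InflRes.isOpen_ker_of_finite ρ) hIU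
    (IsAbsArithFrob.isFrobPow_holds hφ) (QuotientGroup.mk g)
  rw [← QuotientGroup.mk_pow, QuotientGroup.eq] at hi
  have hker : ρ (g⁻¹ * φ ^ i) = LinearMap.id := (ρ.mem_ker _).mp hi
  have hpow : ∀ k : ℕ, ρ (φ ^ k) a = a := by
    intro k
    induction k with
    | zero => rw [pow_zero, map_one, Module.End.one_apply]
    | succ k ih => rw [pow_succ, map_mul, Module.End.mul_apply, ha, ih]
  have h3 : ρ g⁻¹ (ρ (φ ^ i) a) = a := by
    rw [← Module.End.mul_apply, ← map_mul, hker, LinearMap.id_apply]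
  rw [hpow] at h3
  calc ρ g a = ρ g (ρ g⁻¹ a) := by rw [h3]
    _ = ρ (g * g⁻¹) a := by rw [map_mul, Module.End.mul_apply]
    _ = a := by rw [mul_inv_cancel, map_one, Module.End.one_apply]

/-- **`Q(φ⁻¹) x` is `Γ_F`-fixed** on a finite free unramified `ℤ/N`-module with `P(1) = 0`
(`φ`-fixed by Cayley–Hamilton, `apply_comparisonOp`; then `forall_apply_eq_of_frob_apply_eq`).
[folklore] -/
theorem apply_comparisonOp_of_unramified (N : ℕ) [NeZero N] [Module (ZMod N) M]
    [Module.Free (ZMod N) M] [Module.Finite (ZMod N) M] (hI : ∀ τ ∈ absInertia F, ρ τ = 1)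
    {φ : absoluteGaloisGroup F} (hφ : IsAbsArithFrob φ) (h1 : (ρ.comparisonP N φ).eval 1 = 0)
    (x : M) (g : absoluteGaloisGroup F) :
    ρ g (ρ.comparisonOp N φ x) = ρ.comparisonOp N φ x := by
  haveI : Finite M := Module.finite_of_finite (ZMod N)
  exact forall_apply_eq_of_frob_apply_eq ρ hI hφ (apply_comparisonOp ρ N φ h1 x) g

end Frobenius

end FSComp

end Summit.BirchSwinnertonDyer.Rank1Residual.GaloisImage

end
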